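import Mathlib
import Summits.Ventures.LatticeQCDFlow.TrivializingMaps.TruncatedFlowDecorrelation
import Summits.Ventures.LatticeQCDFlow.TrivializingMaps.AcceptanceFootprint
import Summits.Ventures.LatticeQCDFlow.TrivializingMaps.EssFootprint
import HarnessLib

/-!
HONEST FRAMING: exact (Metropolis-corrected) sampling algorithms for lattice gauge theory; figures
of merit are autocorrelation/cost numbers at stated couplings and volumes; no continuum-physics
claim.

# TruncatedFlowAcceptanceFootprint — THE ACCEPTANCE–FOOTPRINT LAW FOR LÜSCHER'S ORDER-`N` FLOW SAMPLERS
# (THEOREM Q of theory-1 row 88 ∘ the expressivity barrier of `TruncatedFlowDecorrelation`; cell pub-lqcd,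
# lean-2 GEN-5)

THEOREM Q (`AcceptanceFootprint.lean`, theory-1 row 88) says: the equilibrium acceptance of an exact
independence-Metropolis sampler certifies DUAL CLOSENESS of target and proposal
(`integralClose_of_meanAccept`: `acc ≤ ā ⟹ IntegralClose (p·μ) (q·μ) (2(1 − acc))`), and for a STRICTLY
local proposal map this bounds the target's correlations beyond twice the range.  The samplers of
record are NOT strictly local — their proposal is the flow map `Φ_t` of the order-`N` truncated generator
— but `TruncatedFlowDecorrelation.truncatedFlow_abs_cov_target_le` bounds the correlations of ANY law
dual-close to `(Φ_t)_* D[V]` up to the light-cone tail.  Composing the two: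

**`truncatedFlow_abs_cov_boltzmann_le_of_meanAccept`** — `G = SU(n)`, `n ≠ 0`, any continuous action
`S` with target `π = 𝒵⁻¹e^{-S}D[U]`, `T ≥ 0`, `t ∈ [0, T]`, every smooth solution of Lüscher's recursion
for `β·S_W`, every measurable flow map `Φ_t` of `-∂S̃^{[N]}_t` whose push-forward `(Φ_t)_* D[V]` has a
density `q ≥ 0` against `D[U]`, equilibrium acceptance `≥ acc`.  Then for every `m` and all bounded
measurable sup-Lipschitz observables `A` (`a`, `S_A`, `ℓ_A`), `B` (`b`, `S_B`, `ℓ_B`) whose plaquette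
balls of radius `2(N+1)·m` are disjoint:

  `|⟨A B⟩_π − ⟨A⟩_π⟨B⟩_π| ≤ 6(1 − acc)·ab + 2(ℓ_A b + a ℓ_B)·2n e^{ct}(ct)^m/m!`,

`c = coneRate d n B β T N` — EVERY VOLUME.  Read contrapositively (`one_sub_meanAccept_ge`): a target
whose connected correlator across read-set separation `m` exceeds the light-cone tail forces
`1 − acc ≥ (|Cov_π(A,B)| − 2(ℓ_A b + a ℓ_B)ε_m(t))/(6ab)` — at fixed order `N`, flow time and coupling
the REJECTION RATE of the exact order-`N` flow sampler is bounded below by the target's correlations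
beyond the cone, uniformly in `L`: the theorem-shaped form, for the samplers of record, of "the footprint
must grow with the correlation length" (cf. [corpus:paper:arxiv-2211.12806 p3], theory-1 §28).

ESS FORM (§2, appended; theory-1 row 91 `EssFootprint.integralClose_of_sqWeight_sqrt` in place of
`integralClose_of_meanAccept`): with an importance weight `w`, `e^{-S}/𝒵 = w·q`, of second moment
`∫ w² q D[U] ≤ 1 + χ` (population `ESS/N = 1/(1+χ)`, `χ > 0`):
`|Cov_π(A,B)| ≤ 3√χ·ab + 2(ℓ_A b + a ℓ_B)·2n e^{ct}(ct)^m/m!` (`truncatedFlow_abs_cov_boltzmann_le_of_sqWeight`)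
— the reweighting column's footprint law for the exact-time order-`N` flow samplers, every volume.

NOT claimed: any value of `acc`, `χ`, `ξ` or `|Cov_π|` at a physical `β`; any statement for `π_β` beyond
what is fed in as the hypothesis on its correlations; nothing about autocorrelations.

References: M. Lüscher, Commun. Math. Phys. 293 (2010) 899 [Luscher2010Trivializing], §3, §4.1, §4.5;
THEORY-1.md §26–§28.
-/

noncomputable section

namespace Summit.Ventures.LatticeQCDFlow.TrivializingMaps

open MeasureTheory
open Literature.MathematicalPhysics.QuantumFieldTheory
open Literature.MathematicalPhysics.QuantumFieldTheory.Luscher2010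
open Literature.MathematicalPhysics.QuantumFieldTheory.WilsonFlow (coeConfig)
open scoped Matrix Matrix.Norms.Frobenius Nat ContDiff

variable {d L n : ℕ} [NeZero L]

/-- **ACCEPTANCE–FOOTPRINT LAW FOR THE ORDER-`N` FLOW SAMPLERS, EVERY VOLUME.**  Continuous action `S`,
target `π = 𝒵⁻¹e^{-S}D[U]`; proposal = the push-forward of `D[V]` under a measurable flow map `Φ_t`
(`t ∈ [0,T]`, `T ≥ 0`) of the order-`N` truncated generator of a smooth Lüscher solution for `β·S_W`, with
density `q ≥ 0`; equilibrium acceptance of the exact independence sampler `≥ acc`.  Then for all bounded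
measurable sup-Lipschitz observables whose plaquette balls of radius `2(N+1)·m` are disjoint:
`|Cov_π(A,B)| ≤ 6(1 − acc)ab + 2(ℓ_A ε b + a ℓ_B ε)`, `ε = 2n e^{ct}(ct)^m/m!`, `c = coneRate d n B β T N`.
[ours; cf. Luscher2010Trivializing §3, §4.1, §4.5(b)(c)] -/
theorem truncatedFlow_abs_cov_boltzmann_le_of_meanAccept (hn : n ≠ 0) (B : SuBasis n) (β : ℝ)
    (N : ℕ) {T : ℝ} (hT : 0 ≤ T) {Sk : ℕ → AmbConfig d L n → ℝ} {c : ℕ → ℝ}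
    (hsm : ∀ k, ContDiff ℝ ∞ (Sk k)) (hser : IsLuscherSeries B (fun W => β * ambWilsonAction W) Sk c)
    {Φ : ℝ → GaugeConfig d L (Matrix.specialUnitaryGroup (Fin n) ℂ) →
      GaugeConfig d L (Matrix.specialUnitaryGroup (Fin n) ℂ)}
    (hΦ : IsFlowMap (fun t W => -linkGrad B (truncFlowAction Sk t N) W) Φ)
    {t : ℝ} (ht : t ∈ Set.Icc 0 T) (hΦm : Measurable (Φ t))
    {S : GaugeConfig d L (Matrix.specialUnitaryGroup (Fin n) ℂ) → ℝ} (hS : Continuous S)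
    {q : GaugeConfig d L (Matrix.specialUnitaryGroup (Fin n) ℂ) → ℝ} (hq0 : ∀ U, 0 ≤ q U)
    (hqm : Measurable q)
    (hν : (trivialMeasure (Matrix.specialUnitaryGroup (Fin n) ℂ) d L).map (Φ t)
      = (trivialMeasure (Matrix.specialUnitaryGroup (Fin n) ℂ) d L).withDensity
          fun U => ENNReal.ofReal (q U))
    {acc : ℝ}
    (hacc : acc ≤ ∫ U, ∫ U', min (Real.exp (-S U) / (partitionFn S).toReal * q U')
        (Real.exp (-S U') / (partitionFn S).toReal * q U)
        ∂(trivialMeasure (Matrix.specialUnitaryGroup (Fin n) ℂ) d L)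
        ∂(trivialMeasure (Matrix.specialUnitaryGroup (Fin n) ℂ) d L))
    (m : ℕ) {A Bo : GaugeConfig d L (Matrix.specialUnitaryGroup (Fin n) ℂ) → ℝ}
    (hAm : Measurable A) (hBm : Measurable Bo) {a b : ℝ} (hAa : ∀ U, |A U| ≤ a) (hBb : ∀ U, |Bo U| ≤ b)
    {SA SB : Set (Edge d L)} (hA : DependsOn A SA) (hB : DependsOn Bo SB) {ℓA ℓB : ℝ}
    (hAlip : ∀ (U U' : GaugeConfig d L (Matrix.specialUnitaryGroup (Fin n) ℂ)) (η : ℝ),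
      (∀ e ∈ SA, ‖coeConfig U e - coeConfig U' e‖ ≤ η) → |A U - A U'| ≤ ℓA * η)
    (hBlip : ∀ (U U' : GaugeConfig d L (Matrix.specialUnitaryGroup (Fin n) ℂ)) (η : ℝ),
      (∀ e ∈ SB, ‖coeConfig U e - coeConfig U' e‖ ≤ η) → |Bo U - Bo U'| ≤ ℓB * η)
    (hsep : ∀ e ∈ SA, ∀ e' ∈ SB,
      Disjoint (linkBall (2 * (N + 1) * m) e) (linkBall (2 * (N + 1) * m) e')) :
    |∫ U, A U * Bo U ∂(boltzmannMeasure S) -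
        (∫ U, A U ∂(boltzmannMeasure S)) * ∫ U, Bo U ∂(boltzmannMeasure S)| ≤
      6 * (1 - acc) * (a * b) +
        2 * (ℓA * (2 * n * Real.exp (coneRate d n B β T N * t) *
            (coneRate d n B β T N * t) ^ m / (m ! : ℝ)) * b +
          a * (ℓB * (2 * n * Real.exp (coneRate d n B β T N * t) *
            (coneRate d n B β T N * t) ^ m / (m ! : ℝ)))) := by
  obtain ⟨hp0, hpm, hpi, hp1⟩ := Gauge.density_boltzmann_spec (d := d) (L := L) hS
  obtain ⟨hqi, hq1⟩ := Gauge.integrable_of_map_eq_withDensity (d := d) (L := L) hΦm hq0 hqm hν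
  haveI : IsProbabilityMeasure (boltzmannMeasure S) := by
    rw [Gauge.boltzmannMeasure_eq_withDensity hS]
    exact isProbabilityMeasure_withDensity_ofReal hp0 hpi hp1
  -- acceptance ⟹ dual closeness of the target to the proposal `(Φ_t)_* D[V]`
  have hclose : IntegralClose (boltzmannMeasure S)
      ((trivialMeasure (Matrix.specialUnitaryGroup (Fin n) ℂ) d L).map (Φ t)) (2 * (1 - acc)) := by
    rw [Gauge.boltzmannMeasure_eq_withDensity hS, hν]
    unfold trivialMeasure at hpi hp1 hqi hq1 hacc ⊢
    exact integralClose_of_meanAccept hp0 hpm hpi hp1 hq0 hqm hqi hq1 hacc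
  -- the expressivity barrier of the order-`N` flow proposal
  have h := truncatedFlow_abs_cov_target_le hn B β N hT hsm hser hΦ ht hΦm m (boltzmannMeasure S) hclose
    hAm hBm hAa hBb hA hB hAlip hBlip hsep
  linarith

/-- **REJECTION FLOOR FROM CORRELATIONS BEYOND THE CONE** (the same law, solved for the acceptance).
Under the hypotheses of `truncatedFlow_abs_cov_boltzmann_le_of_meanAccept`, with `0 < a`, `0 < b`:
`1 − acc ≥ (|Cov_π(A,B)| − 2(ℓ_A ε b + a ℓ_B ε)) / (6ab)`, `ε = 2n e^{ct}(ct)^m/m!` — every volume.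
[ours] -/
theorem truncatedFlow_one_sub_meanAccept_ge (hn : n ≠ 0) (B : SuBasis n) (β : ℝ) (N : ℕ) {T : ℝ}
    (hT : 0 ≤ T) {Sk : ℕ → AmbConfig d L n → ℝ} {c : ℕ → ℝ} (hsm : ∀ k, ContDiff ℝ ∞ (Sk k))
    (hser : IsLuscherSeries B (fun W => β * ambWilsonAction W) Sk c)
    {Φ : ℝ → GaugeConfig d L (Matrix.specialUnitaryGroup (Fin n) ℂ) →
      GaugeConfig d L (Matrix.specialUnitaryGroup (Fin n) ℂ)}
    (hΦ : IsFlowMap (fun t W => -linkGrad B (truncFlowAction Sk t N) W) Φ)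
    {t : ℝ} (ht : t ∈ Set.Icc 0 T) (hΦm : Measurable (Φ t))
    {S : GaugeConfig d L (Matrix.specialUnitaryGroup (Fin n) ℂ) → ℝ} (hS : Continuous S)
    {q : GaugeConfig d L (Matrix.specialUnitaryGroup (Fin n) ℂ) → ℝ} (hq0 : ∀ U, 0 ≤ q U)
    (hqm : Measurable q)
    (hν : (trivialMeasure (Matrix.specialUnitaryGroup (Fin n) ℂ) d L).map (Φ t)
      = (trivialMeasure (Matrix.specialUnitaryGroup (Fin n) ℂ) d L).withDensity
          fun U => ENNReal.ofReal (q U))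
    {acc : ℝ}
    (hacc : acc ≤ ∫ U, ∫ U', min (Real.exp (-S U) / (partitionFn S).toReal * q U')
        (Real.exp (-S U') / (partitionFn S).toReal * q U)
        ∂(trivialMeasure (Matrix.specialUnitaryGroup (Fin n) ℂ) d L)
        ∂(trivialMeasure (Matrix.specialUnitaryGroup (Fin n) ℂ) d L))
    (m : ℕ) {A Bo : GaugeConfig d L (Matrix.specialUnitaryGroup (Fin n) ℂ) → ℝ}
    (hAm : Measurable A) (hBm : Measurable Bo) {a b : ℝ} (ha : 0 < a) (hb : 0 < b)
    (hAa : ∀ U, |A U| ≤ a) (hBb : ∀ U, |Bo U| ≤ b)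
    {SA SB : Set (Edge d L)} (hA : DependsOn A SA) (hB : DependsOn Bo SB) {ℓA ℓB : ℝ}
    (hAlip : ∀ (U U' : GaugeConfig d L (Matrix.specialUnitaryGroup (Fin n) ℂ)) (η : ℝ),
      (∀ e ∈ SA, ‖coeConfig U e - coeConfig U' e‖ ≤ η) → |A U - A U'| ≤ ℓA * η)
    (hBlip : ∀ (U U' : GaugeConfig d L (Matrix.specialUnitaryGroup (Fin n) ℂ)) (η : ℝ),
      (∀ e ∈ SB, ‖coeConfig U e - coeConfig U' e‖ ≤ η) → |Bo U - Bo U'| ≤ ℓB * η)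
    (hsep : ∀ e ∈ SA, ∀ e' ∈ SB,
      Disjoint (linkBall (2 * (N + 1) * m) e) (linkBall (2 * (N + 1) * m) e')) :
    (|∫ U, A U * Bo U ∂(boltzmannMeasure S) -
        (∫ U, A U ∂(boltzmannMeasure S)) * ∫ U, Bo U ∂(boltzmannMeasure S)| -
      2 * (ℓA * (2 * n * Real.exp (coneRate d n B β T N * t) *
            (coneRate d n B β T N * t) ^ m / (m ! : ℝ)) * b +
          a * (ℓB * (2 * n * Real.exp (coneRate d n B β T N * t) *
            (coneRate d n B β T N * t) ^ m / (m ! : ℝ))))) / (6 * (a * b)) ≤ 1 - acc := by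
  have h := truncatedFlow_abs_cov_boltzmann_le_of_meanAccept hn B β N hT hsm hser hΦ ht hΦm hS hq0 hqm hν
    hacc m hAm hBm hAa hBb hA hB hAlip hBlip hsep
  have hab : 0 < 6 * (a * b) := by positivity
  rw [div_le_iff₀ hab]
  linarith

/-! ## §2. The ESS form (reweighting column) -/

/-- **ESS–FOOTPRINT LAW FOR THE ORDER-`N` FLOW SAMPLERS, EVERY VOLUME.**  Continuous action `S`, target
`π = 𝒵⁻¹e^{-S}D[U]`; proposal `(Φ_t)_* D[V]` (measurable flow map `Φ_t` of the order-`N` truncated generator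
of a smooth Lüscher solution for `β·S_W`, `t ∈ [0,T]`, `T ≥ 0`) with density `q ≥ 0`; importance weight
`w` with `e^{-S}/𝒵 = w·q` and `∫ w² q D[U] ≤ 1 + χ`, `χ > 0` (population `ESS/N = 1/(1+χ)`).  Then for all
bounded measurable sup-Lipschitz observables whose plaquette balls of radius `2(N+1)·m` are disjoint:
`|Cov_π(A,B)| ≤ 3√χ·ab + 2(ℓ_A ε b + a ℓ_B ε)`, `ε = 2n e^{ct}(ct)^m/m!`, `c = coneRate d n B β T N`.
[ours; cf. Luscher2010Trivializing §3, §4.1, §4.5(b)(c)] -/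
theorem truncatedFlow_abs_cov_boltzmann_le_of_sqWeight (hn : n ≠ 0) (B : SuBasis n) (β : ℝ) (N : ℕ)
    {T : ℝ} (hT : 0 ≤ T) {Sk : ℕ → AmbConfig d L n → ℝ} {c : ℕ → ℝ} (hsm : ∀ k, ContDiff ℝ ∞ (Sk k))
    (hser : IsLuscherSeries B (fun W => β * ambWilsonAction W) Sk c)
    {Φ : ℝ → GaugeConfig d L (Matrix.specialUnitaryGroup (Fin n) ℂ) →
      GaugeConfig d L (Matrix.specialUnitaryGroup (Fin n) ℂ)}
    (hΦ : IsFlowMap (fun t W => -linkGrad B (truncFlowAction Sk t N) W) Φ)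
    {t : ℝ} (ht : t ∈ Set.Icc 0 T) (hΦm : Measurable (Φ t))
    {S : GaugeConfig d L (Matrix.specialUnitaryGroup (Fin n) ℂ) → ℝ} (hS : Continuous S)
    {q w : GaugeConfig d L (Matrix.specialUnitaryGroup (Fin n) ℂ) → ℝ} (hq0 : ∀ U, 0 ≤ q U)
    (hqm : Measurable q)
    (hν : (trivialMeasure (Matrix.specialUnitaryGroup (Fin n) ℂ) d L).map (Φ t)
      = (trivialMeasure (Matrix.specialUnitaryGroup (Fin n) ℂ) d L).withDensity
          fun U => ENNReal.ofReal (q U))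
    (hw : ∀ U, Real.exp (-S U) / (partitionFn S).toReal = w U * q U)
    (hw2i : Integrable (fun U => w U ^ 2 * q U)
      (trivialMeasure (Matrix.specialUnitaryGroup (Fin n) ℂ) d L))
    {χ : ℝ}
    (hchi : ∫ U, w U ^ 2 * q U ∂(trivialMeasure (Matrix.specialUnitaryGroup (Fin n) ℂ) d L) ≤ 1 + χ)
    (hχ : 0 < χ) (m : ℕ) {A Bo : GaugeConfig d L (Matrix.specialUnitaryGroup (Fin n) ℂ) → ℝ}
    (hAm : Measurable A) (hBm : Measurable Bo) {a b : ℝ} (hAa : ∀ U, |A U| ≤ a) (hBb : ∀ U, |Bo U| ≤ b)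
    {SA SB : Set (Edge d L)} (hA : DependsOn A SA) (hB : DependsOn Bo SB) {ℓA ℓB : ℝ}
    (hAlip : ∀ (U U' : GaugeConfig d L (Matrix.specialUnitaryGroup (Fin n) ℂ)) (η : ℝ),
      (∀ e ∈ SA, ‖coeConfig U e - coeConfig U' e‖ ≤ η) → |A U - A U'| ≤ ℓA * η)
    (hBlip : ∀ (U U' : GaugeConfig d L (Matrix.specialUnitaryGroup (Fin n) ℂ)) (η : ℝ),
      (∀ e ∈ SB, ‖coeConfig U e - coeConfig U' e‖ ≤ η) → |Bo U - Bo U'| ≤ ℓB * η)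
    (hsep : ∀ e ∈ SA, ∀ e' ∈ SB,
      Disjoint (linkBall (2 * (N + 1) * m) e) (linkBall (2 * (N + 1) * m) e')) :
    |∫ U, A U * Bo U ∂(boltzmannMeasure S) -
        (∫ U, A U ∂(boltzmannMeasure S)) * ∫ U, Bo U ∂(boltzmannMeasure S)| ≤
      3 * Real.sqrt χ * (a * b) +
        2 * (ℓA * (2 * n * Real.exp (coneRate d n B β T N * t) *
            (coneRate d n B β T N * t) ^ m / (m ! : ℝ)) * b +
          a * (ℓB * (2 * n * Real.exp (coneRate d n B β T N * t) *
            (coneRate d n B β T N * t) ^ m / (m ! : ℝ)))) := by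
  obtain ⟨hp0, hpm, hpi, hp1⟩ := Gauge.density_boltzmann_spec (d := d) (L := L) hS
  obtain ⟨hqi, hq1⟩ := Gauge.integrable_of_map_eq_withDensity (d := d) (L := L) hΦm hq0 hqm hν
  haveI : IsProbabilityMeasure (boltzmannMeasure S) := by
    rw [Gauge.boltzmannMeasure_eq_withDensity hS]
    exact isProbabilityMeasure_withDensity_ofReal hp0 hpi hp1
  -- second moment of the weight ⟹ dual closeness of the target to the proposal `(Φ_t)_* D[V]`
  have hclose : IntegralClose (boltzmannMeasure S)
      ((trivialMeasure (Matrix.specialUnitaryGroup (Fin n) ℂ) d L).map (Φ t)) (Real.sqrt χ) := by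
    rw [Gauge.boltzmannMeasure_eq_withDensity hS, hν]
    unfold trivialMeasure at hpi hp1 hqi hq1 hw2i hchi ⊢
    exact integralClose_of_sqWeight_sqrt hp0 hpm hpi hp1 hq0 hqm hqi hq1 hw hw2i hchi hχ
  exact truncatedFlow_abs_cov_target_le hn B β N hT hsm hser hΦ ht hΦm m (boltzmannMeasure S) hclose
    hAm hBm hAa hBb hA hB hAlip hBlip hsep

end Summit.Ventures.LatticeQCDFlow.TrivializingMaps

end
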